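import Literature.Computability.AlgebraicComplexity.GrenetEquivariant
import Literature.Computability.AlgebraicComplexity.LRPencilOfMatrix

/-!
# Crux `ProjectionStability.OptStep` (stmt-ValiantsHypothesis-17835), line `Sketch` —
# registered stub `stub_grenet_gaugeRigid` (S4): gauge rigidity of Grenet's matrix

**Claim settled.** For Grenet's affine matrix `G = Grenet.repr ℂ n e` (size `N = 2ⁿ - 1`; row `p`
carries the subset `ρ p = e⁻¹ ((e univ).succAbove p) ≠ univ` of `Fin n`, column `q` the subset
`κ q = e⁻¹ ((e ∅).succAbove q) ≠ ∅`; entry `±([ρ p = κ q] - [κ q = insert j (ρ p)] · X (j, |ρ p|))`)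
the constant-gauge stabiliser is the scalars: if constant matrices `P, Q` satisfy `P · G = G · Q`
then `P = Q = c • 1` for one scalar `c`.

**Proof.** The global sign `(-1)^(e univ + e ∅)` is a unit and cancels. Taking the coefficient of
each monomial `d` in `P · G = G · Q` gives `P · G_d = G_d · Q` over the scalars, entry by entry
(the hypothesis `h` of the abstract lemmas), where `G_0 = ([S = T])` and
`G_{X (j,c)} = -([j ∉ S, T = insert j S, |S| = c])` (`coeff_one_sub_adj_zero`,
`coeff_one_sub_adj_single`). Each `G_{X (j,c)}` is a partial matching between rows and columns (the
arcs `S → insert j S`, `|S| = c`, of Grenet's branching program), so entry `(a, b)` of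
`P · G_d = G_d · Q` has at most one summand on each side (`lhs_eq`, `rhs_eq`, `lhs_eq_zero`,
`rhs_eq_zero`). Choosing `(j, c, a, b)` suitably: `Q` is diagonal (`Q_offdiag`: for columns
`y ≠ b` some `j ∈ κ y` has `j ∉ κ b` or `|κ b| ≠ |κ y|`), `P` is diagonal (`P_offdiag`),
`P_{x,x} = Q_{y,y}` along every arc `ρ x → κ y` (`diag_eq_of_arc`) and whenever `ρ x = κ y`
(`diag_eq_of_same`, from `G_0`); walking up from `∅` by `Finset.induction_on`, all diagonal
entries equal `P_{x₀,x₀}` for the row `x₀` of `∅` (`Q_diag_eq`, `P_diag_eq`, `rigid_of_entries`).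
Degenerate case `n = 0`: `N = 0` and `c = 0` works (`gaugeRigid`).

The abstract lemmas are stated for arbitrary labellings `ρ κ : Fin N → Finset (Fin n)` (injective,
onto the subsets `≠ univ`, resp. `≠ ∅`) and an arbitrary commutative ring of scalars `k`; the
registered signature is the case `k = ℂ` (`stub_grenet_gaugeRigid`). Unconditional; no named facts;
no new definitions. References: B. Grenet, *An upper bound for the permanent versus determinant
problem* (2011), Thm. 1 (the matrix, `Grenet.repr`); the rigidity statement itself is folklore
linear algebra (idea card `symmetry-patching-lr`, item `GaugeRigid`).
-/

-- layout Summits/ValiantsHypothesis/ValiantsHypothesis forces the duplicated namespace component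
set_option linter.dupNamespace false

noncomputable section

namespace Summit.ValiantsHypothesis.ValiantsHypothesis.Theorems.ProjectionStabilityOptStep.GrenetGaugeRigid

open MvPolynomial Matrix Finset
open Literature.Computability.AlgebraicComplexity

variable {k : Type*} [CommRing k] {n N : ℕ}

/-! ### Coefficients of the entries of `1 - adj` -/

/-- The coefficient of `X (j, c)` in a weight `wt i m` (`= X (i, m)` or `0`). [folklore] -/
theorem coeff_wt_single (i j c : Fin n) (m : ℕ) :
    coeff (Finsupp.single (j, c) 1) (Grenet.wt k n i m) = if i = j ∧ m = (c : ℕ) then 1 else 0 := by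
  unfold Grenet.wt
  by_cases hm : m < n
  · rw [dif_pos hm, coeff_X]
    refine if_congr ?_ rfl rfl
    rw [Finsupp.single_left_inj one_ne_zero, Prod.mk.injEq]
    exact and_congr Iff.rfl ⟨fun h => by subst h; rfl, fun h => Fin.ext h⟩
  · rw [dif_neg hm, coeff_zero, if_neg fun h => hm (h.2.trans_lt c.isLt)]

/-- The coefficient of `X (j, c)` in `adj S T` is `[j ∉ S, T = insert j S, |S| = c]`. [folklore] -/
theorem coeff_adj_single (j c : Fin n) (S T : Finset (Fin n)) :
    coeff (Finsupp.single (j, c) 1) (Grenet.adj k n S T) =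
      if j ∉ S ∧ T = insert j S ∧ S.card = (c : ℕ) then 1 else 0 := by
  rw [Grenet.adj_apply, coeff_sum, Finset.sum_eq_single j]
  · by_cases hj : j ∉ S ∧ T = insert j S
    · rw [if_pos hj, coeff_wt_single]
      exact if_congr ⟨fun h => ⟨hj.1, hj.2, h.2⟩, fun h => ⟨rfl, h.2.2⟩⟩ rfl rfl
    · rw [if_neg hj, coeff_zero, if_neg fun h => hj ⟨h.1, h.2.1⟩]
  · intro i _ hij
    by_cases hi : i ∉ S ∧ T = insert i S
    · rw [if_pos hi, coeff_wt_single, if_neg fun h => hij h.1]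
    · rw [if_neg hi, coeff_zero]
  · exact fun h => absurd (mem_univ j) h

/-- The coefficient of `X (j, c)` in `(1 - adj) S T` is `-[j ∉ S, T = insert j S, |S| = c]`.
[folklore] -/
theorem coeff_one_sub_adj_single (j c : Fin n) (S T : Finset (Fin n)) :
    coeff (Finsupp.single (j, c) 1) ((1 - Grenet.adj k n) S T) =
      if j ∉ S ∧ T = insert j S ∧ S.card = (c : ℕ) then -1 else 0 := by
  rw [Matrix.sub_apply, coeff_sub, coeff_adj_single, Matrix.one_apply]
  have h1 : coeff (Finsupp.single (j, c) 1)
      (if S = T then (1 : MvPolynomial (Fin n × Fin n) k) else 0) = 0 := by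
    split_ifs
    · rw [coeff_one, if_neg (Finsupp.single_ne_zero.mpr one_ne_zero).symm]
    · exact coeff_zero _
  rw [h1, zero_sub]
  split_ifs
  · rfl
  · exact neg_zero

/-- The constant coefficient of `(1 - adj) S T` is `[S = T]` (weights have no constant term).
[folklore] -/
theorem coeff_one_sub_adj_zero (S T : Finset (Fin n)) :
    coeff 0 ((1 - Grenet.adj k n) S T) = if S = T then 1 else 0 := by
  rw [Matrix.sub_apply, coeff_sub, Matrix.one_apply, Grenet.adj_apply, coeff_sum,
    Finset.sum_eq_zero, sub_zero]
  · split_ifs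
    · exact coeff_zero_one
    · exact coeff_zero _
  · intro i _
    split_ifs
    · unfold Grenet.wt
      split_ifs
      · exact coeff_zero_X _
      · exact coeff_zero _
    · exact coeff_zero _

/-! ### Abstract rigidity: rows labelled by `ρ`, columns by `κ` -/

section Abstract

variable (ρ κ : Fin N → Finset (Fin n)) {P Q : Matrix (Fin N) (Fin N) k}

/-- Two arcs inserting the same `j` with the same head have the same tail. [folklore] -/
theorem tail_unique (hρ : Function.Injective ρ) {j : Fin n} {x x' : Fin N} (hx : j ∉ ρ x)
    (hx' : j ∉ ρ x') (hxx' : insert j (ρ x) = insert j (ρ x')) : x = x' :=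
  hρ (by rw [← erase_insert hx, hxx', erase_insert hx'])

/-- Left side at the weight `X (j, c)`: only the tail `x₀` of the arc into column `b` contributes.
[folklore] -/
theorem lhs_eq (hρ : Function.Injective ρ) {j c : Fin n} (a : Fin N) {x₀ b : Fin N}
    (hj : j ∉ ρ x₀) (hb : κ b = insert j (ρ x₀)) (hc : (ρ x₀).card = (c : ℕ)) :
    ∑ x, P a x * coeff (Finsupp.single (j, c) 1) ((1 - Grenet.adj k n) (ρ x) (κ b)) = -P a x₀ := by
  rw [Fintype.sum_eq_single x₀, coeff_one_sub_adj_single, if_pos ⟨hj, hb, hc⟩, mul_neg_one]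
  intro x hx
  rw [coeff_one_sub_adj_single,
    if_neg fun h' => hx (tail_unique ρ hρ h'.1 hj (h'.2.1.symm.trans hb)), mul_zero]

/-- Left side at the weight `X (j, c)` vanishes when no such arc enters column `b`. [folklore] -/
theorem lhs_eq_zero {j c : Fin n} (a b : Fin N)
    (hb : ∀ x, j ∉ ρ x → κ b = insert j (ρ x) → (ρ x).card ≠ (c : ℕ)) :
    ∑ x, P a x * coeff (Finsupp.single (j, c) 1) ((1 - Grenet.adj k n) (ρ x) (κ b)) = 0 :=
  Finset.sum_eq_zero fun x _ => by
    rw [coeff_one_sub_adj_single, if_neg fun h' => hb x h'.1 h'.2.1 h'.2.2, mul_zero]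

/-- Right side at the weight `X (j, c)`: only the head `y₀` of the arc out of row `a` contributes.
[folklore] -/
theorem rhs_eq (hκ : Function.Injective κ) {j c : Fin n} {a y₀ : Fin N} (b : Fin N)
    (hj : j ∉ ρ a) (hy : κ y₀ = insert j (ρ a)) (hc : (ρ a).card = (c : ℕ)) :
    ∑ y, coeff (Finsupp.single (j, c) 1) ((1 - Grenet.adj k n) (ρ a) (κ y)) * Q y b = -Q y₀ b := by
  rw [Fintype.sum_eq_single y₀, coeff_one_sub_adj_single, if_pos ⟨hj, hy, hc⟩, neg_one_mul]
  intro y hy'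
  rw [coeff_one_sub_adj_single, if_neg fun h' => hy' (hκ (h'.2.1.trans hy.symm)), zero_mul]

/-- Right side at the weight `X (j, c)` vanishes when row `a` emits no such arc. [folklore] -/
theorem rhs_eq_zero {j c : Fin n} (a b : Fin N) (ha : j ∉ ρ a → (ρ a).card ≠ (c : ℕ)) :
    ∑ y, coeff (Finsupp.single (j, c) 1) ((1 - Grenet.adj k n) (ρ a) (κ y)) * Q y b = 0 :=
  Finset.sum_eq_zero fun y _ => by
    rw [coeff_one_sub_adj_single, if_neg fun h' => ha h'.1 h'.2.2, zero_mul]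

/-- Constant term: `P_{x,x} = Q_{y,y}` when row `x` and column `y` carry the same subset.
[folklore] -/
theorem diag_eq_of_same (hρ : Function.Injective ρ) (hκ : Function.Injective κ)
    (h : ∀ (d : Fin n × Fin n →₀ ℕ) (a b : Fin N),
      ∑ x, P a x * coeff d ((1 - Grenet.adj k n) (ρ x) (κ b)) =
        ∑ y, coeff d ((1 - Grenet.adj k n) (ρ a) (κ y)) * Q y b)
    {x y : Fin N} (hxy : ρ x = κ y) : P x x = Q y y := by
  have hl : ∑ x', P x x' * coeff 0 ((1 - Grenet.adj k n) (ρ x') (κ y)) = P x x := by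
    rw [Fintype.sum_eq_single x, coeff_one_sub_adj_zero, if_pos hxy, mul_one]
    intro x' hx'
    rw [coeff_one_sub_adj_zero, if_neg fun h' => hx' (hρ (h'.trans hxy.symm)), mul_zero]
  have hr : ∑ y', coeff 0 ((1 - Grenet.adj k n) (ρ x) (κ y')) * Q y' y = Q y y := by
    rw [Fintype.sum_eq_single y, coeff_one_sub_adj_zero, if_pos hxy, one_mul]
    intro y' hy'
    rw [coeff_one_sub_adj_zero, if_neg fun h' => hy' (hκ (h'.symm.trans hxy)), zero_mul]
  rw [← hl, ← hr]
  exact h 0 x y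

/-- Weight `X (j, |ρ x|)`: `P_{x,x} = Q_{y,y}` along every arc `ρ x → κ y = insert j (ρ x)`.
[folklore] -/
theorem diag_eq_of_arc (hρ : Function.Injective ρ) (hκ : Function.Injective κ)
    (h : ∀ (d : Fin n × Fin n →₀ ℕ) (a b : Fin N),
      ∑ x, P a x * coeff d ((1 - Grenet.adj k n) (ρ x) (κ b)) =
        ∑ y, coeff d ((1 - Grenet.adj k n) (ρ a) (κ y)) * Q y b)
    {j : Fin n} {x y : Fin N} (hj : j ∉ ρ x) (hy : κ y = insert j (ρ x)) : P x x = Q y y := by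
  obtain ⟨c, hc⟩ : ∃ c : Fin n, (ρ x).card = (c : ℕ) := ⟨⟨_, Grenet.card_lt_of_notMem hj⟩, rfl⟩
  have := h (Finsupp.single (j, c) 1) x y
  rw [lhs_eq ρ κ hρ x hj hy hc, rhs_eq ρ κ hκ y hj hy hc, neg_inj] at this
  exact this

/-- `Q` is diagonal: for columns `y ≠ b` some `j ∈ κ y` is missing from `κ b` or the two
cardinalities differ; the arc `κ y ∖ {j} → κ y` then isolates `Q_{y,b}`. [folklore] -/
theorem Q_offdiag (hκ : Function.Injective κ) (hκe : ∀ q, κ q ≠ ∅)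
    (hρs : ∀ S, S ≠ univ → ∃ p, ρ p = S)
    (h : ∀ (d : Fin n × Fin n →₀ ℕ) (a b : Fin N),
      ∑ x, P a x * coeff d ((1 - Grenet.adj k n) (ρ x) (κ b)) =
        ∑ y, coeff d ((1 - Grenet.adj k n) (ρ a) (κ y)) * Q y b)
    {y b : Fin N} (hyb : y ≠ b) : Q y b = 0 := by
  obtain ⟨j, hjy, hj⟩ : ∃ j ∈ κ y, ¬ (j ∈ κ b ∧ (κ b).card = (κ y).card) := by
    by_contra hcon
    push Not at hcon
    obtain ⟨j₀, hj₀⟩ := nonempty_iff_ne_empty.mpr (hκe y)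
    exact hyb (hκ (eq_of_subset_of_card_le (fun j hj => (hcon j hj).1) (hcon j₀ hj₀).2.le))
  obtain ⟨a, ha⟩ := hρs ((κ y).erase j) fun h' => notMem_erase j (κ y) (h'.symm ▸ mem_univ j)
  have hja : j ∉ ρ a := by rw [ha]; exact notMem_erase j _
  obtain ⟨c, hc⟩ : ∃ c : Fin n, (ρ a).card = (c : ℕ) := ⟨⟨_, Grenet.card_lt_of_notMem hja⟩, rfl⟩
  have hnone : ∀ x, j ∉ ρ x → κ b = insert j (ρ x) → (ρ x).card ≠ (c : ℕ) :=
    fun x hx hb hxc => hj ⟨hb ▸ mem_insert_self j _, by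
      rw [hb, card_insert_of_notMem hx, hxc, ← hc, ha, card_erase_add_one hjy]⟩
  have := h (Finsupp.single (j, c) 1) a b
  rw [lhs_eq_zero ρ κ a b hnone, rhs_eq ρ κ hκ b hja (by rw [ha, insert_erase hjy]) hc,
    zero_eq_neg] at this
  exact this

/-- `P` is diagonal: the arc `ρ x → insert j (ρ x)` isolates `P_{a,x}` on the left, and the right
side is an off-diagonal entry of `Q` (or empty). [folklore] -/
theorem P_offdiag (hρ : Function.Injective ρ) (hκ : Function.Injective κ)
    (hρu : ∀ p, ρ p ≠ univ) (hκe : ∀ q, κ q ≠ ∅) (hρs : ∀ S, S ≠ univ → ∃ p, ρ p = S)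
    (hκs : ∀ T, T ≠ ∅ → ∃ q, κ q = T)
    (h : ∀ (d : Fin n × Fin n →₀ ℕ) (a b : Fin N),
      ∑ x, P a x * coeff d ((1 - Grenet.adj k n) (ρ x) (κ b)) =
        ∑ y, coeff d ((1 - Grenet.adj k n) (ρ a) (κ y)) * Q y b)
    {a x : Fin N} (hax : a ≠ x) : P a x = 0 := by
  obtain ⟨j, hj⟩ : ∃ j, j ∉ ρ x := not_forall.mp (mt eq_univ_iff_forall.mpr (hρu x))
  obtain ⟨c, hc⟩ : ∃ c : Fin n, (ρ x).card = (c : ℕ) := ⟨⟨_, Grenet.card_lt_of_notMem hj⟩, rfl⟩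
  obtain ⟨b, hb⟩ := hκs _ (insert_ne_empty j (ρ x))
  have hR : ∑ y, coeff (Finsupp.single (j, c) 1) ((1 - Grenet.adj k n) (ρ a) (κ y)) * Q y b = 0 := by
    by_cases hay : j ∉ ρ a ∧ (ρ a).card = (c : ℕ)
    · obtain ⟨y, hy⟩ := hκs _ (insert_ne_empty j (ρ a))
      have hyb : y ≠ b := by
        rintro rfl
        exact hax (tail_unique ρ hρ hay.1 hj (hy.symm.trans hb))
      rw [rhs_eq ρ κ hκ b hay.1 hy hay.2, Q_offdiag ρ κ hκ hκe hρs h hyb, neg_zero]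
    · exact rhs_eq_zero ρ κ a b fun hja hca => hay ⟨hja, hca⟩
  have := h (Finsupp.single (j, c) 1) a b
  rw [lhs_eq ρ κ hρ a hj hb hc, hR, neg_eq_zero] at this
  exact this

/-- All diagonal entries of `Q` equal `P_{x₀,x₀}` for the row `x₀` of `∅`: induction on the column
subset, walking up the arcs `S → insert j S` and across the constant term. [folklore] -/
theorem Q_diag_eq (hρ : Function.Injective ρ) (hκ : Function.Injective κ) (hκe : ∀ q, κ q ≠ ∅)
    (hρs : ∀ S, S ≠ univ → ∃ p, ρ p = S) (hκs : ∀ T, T ≠ ∅ → ∃ q, κ q = T)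
    (h : ∀ (d : Fin n × Fin n →₀ ℕ) (a b : Fin N),
      ∑ x, P a x * coeff d ((1 - Grenet.adj k n) (ρ x) (κ b)) =
        ∑ y, coeff d ((1 - Grenet.adj k n) (ρ a) (κ y)) * Q y b)
    (x₀ : Fin N) (hx₀ : ρ x₀ = ∅) (y : Fin N) : Q y y = P x₀ x₀ := by
  suffices H : ∀ T : Finset (Fin n), T ≠ ∅ → ∀ y, κ y = T → Q y y = P x₀ x₀ from
    H _ (hκe y) y rfl
  intro T
  induction T using Finset.induction_on with
  | empty => exact fun hT _ _ => absurd rfl hT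
  | insert j S hjS ih =>
    intro _ y hy
    by_cases hS : S = ∅
    · subst hS
      exact (diag_eq_of_arc ρ κ hρ hκ h (x := x₀) (by rw [hx₀]; exact notMem_empty j)
        (by rw [hy, hx₀])).symm
    · obtain ⟨x, hx⟩ := hρs S fun hSu => hjS (hSu ▸ mem_univ j)
      obtain ⟨y', hy'⟩ := hκs S hS
      rw [← diag_eq_of_arc ρ κ hρ hκ h (x := x) (by rw [hx]; exact hjS) (by rw [hy, hx]),
        diag_eq_of_same ρ κ hρ hκ h (hx.trans hy'.symm)]
      exact ih hS y' hy'

/-- All diagonal entries of `P` equal `P_{x₀,x₀}`: leave row `x` along any arc and use `Q_diag_eq`.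
[folklore] -/
theorem P_diag_eq (hρ : Function.Injective ρ) (hκ : Function.Injective κ)
    (hρu : ∀ p, ρ p ≠ univ) (hκe : ∀ q, κ q ≠ ∅) (hρs : ∀ S, S ≠ univ → ∃ p, ρ p = S)
    (hκs : ∀ T, T ≠ ∅ → ∃ q, κ q = T)
    (h : ∀ (d : Fin n × Fin n →₀ ℕ) (a b : Fin N),
      ∑ x, P a x * coeff d ((1 - Grenet.adj k n) (ρ x) (κ b)) =
        ∑ y, coeff d ((1 - Grenet.adj k n) (ρ a) (κ y)) * Q y b)
    (x₀ : Fin N) (hx₀ : ρ x₀ = ∅) (x : Fin N) : P x x = P x₀ x₀ := by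
  obtain ⟨j, hj⟩ : ∃ j, j ∉ ρ x := not_forall.mp (mt eq_univ_iff_forall.mpr (hρu x))
  obtain ⟨y, hy⟩ := hκs _ (insert_ne_empty j (ρ x))
  rw [diag_eq_of_arc ρ κ hρ hκ h hj hy]
  exact Q_diag_eq ρ κ hρ hκ hκe hρs hκs h x₀ hx₀ y

/-- **Abstract rigidity.** If the labellings `ρ`, `κ` are injective onto the subsets `≠ univ`,
resp. `≠ ∅`, `∅ ≠ univ`, and `(P, Q)` satisfies the coefficient equations `P · G_d = G_d · Q` of
`G p q = (1 - adj) (ρ p) (κ q)`, then `P = Q = c • 1`. [folklore] -/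
theorem rigid_of_entries (hρ : Function.Injective ρ) (hκ : Function.Injective κ)
    (hρu : ∀ p, ρ p ≠ univ) (hκe : ∀ q, κ q ≠ ∅) (hρs : ∀ S, S ≠ univ → ∃ p, ρ p = S)
    (hκs : ∀ T, T ≠ ∅ → ∃ q, κ q = T)
    (h : ∀ (d : Fin n × Fin n →₀ ℕ) (a b : Fin N),
      ∑ x, P a x * coeff d ((1 - Grenet.adj k n) (ρ x) (κ b)) =
        ∑ y, coeff d ((1 - Grenet.adj k n) (ρ a) (κ y)) * Q y b)
    (hne : (∅ : Finset (Fin n)) ≠ univ) : ∃ c : k, P = c • 1 ∧ Q = c • 1 := by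
  obtain ⟨x₀, hx₀⟩ := hρs ∅ hne
  refine ⟨P x₀ x₀, ?_, ?_⟩
  · ext a x
    rw [Matrix.smul_apply, Matrix.one_apply, smul_eq_mul, mul_ite, mul_one, mul_zero]
    split_ifs with hax
    · subst hax
      exact P_diag_eq ρ κ hρ hκ hρu hκe hρs hκs h x₀ hx₀ a
    · exact P_offdiag ρ κ hρ hκ hρu hκe hρs hκs h hax
  · ext y b
    rw [Matrix.smul_apply, Matrix.one_apply, smul_eq_mul, mul_ite, mul_one, mul_zero]
    split_ifs with hyb
    · subst hyb
      exact Q_diag_eq ρ κ hρ hκ hκe hρs hκs h x₀ hx₀ y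
    · exact Q_offdiag ρ κ hκ hκe hρs h hyb

end Abstract

/-! ### Grenet's matrix -/

/-- **Gauge rigidity of Grenet's matrix** over any commutative ring of scalars (`2ⁿ = N + 1`): a
constant pair `(P, Q)` with `P · G = G · Q`, `G = Grenet.repr k n e`, is `P = Q = c • 1`. The sign of
`G` is a unit and cancels; the rows/columns of the minor are labelled by
`p ↦ e⁻¹ ((e univ).succAbove p)`, `q ↦ e⁻¹ ((e ∅).succAbove q)`; conclude by `rigid_of_entries`.
[folklore] -/
theorem gaugeRigid (e : Finset (Fin n) ≃ Fin (N + 1)) (hN : 2 ^ n = N + 1)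
    {P Q : Matrix (Fin N) (Fin N) k}
    (h : P.map C * Grenet.repr k n e = Grenet.repr k n e * Q.map C) :
    ∃ c : k, P = c • 1 ∧ Q = c • 1 := by
  by_cases hN0 : N = 0
  · subst hN0
    exact ⟨0, Matrix.ext fun i _ => i.elim0, Matrix.ext fun i _ => i.elim0⟩
  have hn : n ≠ 0 := by
    rintro rfl
    rw [pow_zero] at hN
    omega
  haveI : Nonempty (Fin n) := ⟨⟨0, Nat.pos_of_ne_zero hn⟩⟩
  unfold Grenet.repr at h
  rw [Matrix.mul_smul, Matrix.smul_mul] at h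
  have hc := (isUnit_one.neg.pow _).smul_left_cancel.mp h
  refine rigid_of_entries (fun p => e.symm ((e univ).succAbove p))
    (fun q => e.symm ((e ∅).succAbove q))
    (fun _ _ hpq => Fin.succAbove_right_injective (e.symm.injective hpq))
    (fun _ _ hpq => Fin.succAbove_right_injective (e.symm.injective hpq))
    (fun p hp => Fin.succAbove_ne (e univ) p (e.symm_apply_eq.mp hp))
    (fun q hq => Fin.succAbove_ne (e ∅) q (e.symm_apply_eq.mp hq))
    (fun S hS => ?_) (fun T hT => ?_) (fun d a b => ?_) univ_nonempty.ne_empty.symm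
  · obtain ⟨p, hp⟩ := Fin.exists_succAbove_eq (e.injective.ne hS)
    exact ⟨p, show e.symm ((e univ).succAbove p) = S by rw [hp, Equiv.symm_apply_apply]⟩
  · obtain ⟨q, hq⟩ := Fin.exists_succAbove_eq (e.injective.ne hT)
    exact ⟨q, show e.symm ((e ∅).succAbove q) = T by rw [hq, Equiv.symm_apply_apply]⟩
  · have := congrArg (fun A : Matrix (Fin N) (Fin N) (MvPolynomial (Fin n × Fin n) k) =>
      coeff d (A a b)) hc
    simpa only [Matrix.mul_apply, Matrix.map_apply, Matrix.submatrix_apply, coeff_sum,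
      coeff_C_mul, LRPencil.coeff_mul_C'] using this

/-- **S4 — gauge rigidity of Grenet's matrix** (registered stub `stub_grenet_gaugeRigid` of line
`Sketch`, crux `ProjectionStability.OptStep`): the only constant pairs `(P, Q)` with
`P · G = G · Q`, `G = Grenet.repr ℂ n e`, are `P = Q = c • 1`. [folklore] -/
theorem stub_grenet_gaugeRigid :
    ∀ (n N : ℕ) (hN : 2 ^ n = N + 1) (e : Finset (Fin n) ≃ Fin (N + 1)) (P Q : Matrix (Fin N) (Fin N) ℂ),
      P.map C * Grenet.repr ℂ n e = Grenet.repr ℂ n e * Q.map C → ∃ c : ℂ, P = c • 1 ∧ Q = c • 1 :=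
  fun _ _ hN e _ _ h => gaugeRigid e hN h

end Summit.ValiantsHypothesis.ValiantsHypothesis.Theorems.ProjectionStabilityOptStep.GrenetGaugeRigid

end
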